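import Summits.Ventures.HSemireg.Mod4MiddleMatrixSquareRoot
import Summits.Ventures.HSemireg.WedgeHankelModel

/-!
# Venture HSemireg — MOD-4 line: the TWO-SLOPE middle-degree matrix `M_f(q)` for `f = A e^{λh} + B e^{μh}` and its spectrum,
# for EVERY `n` (THEOREM R₂'s box/G dichotomy in closed form: `dim ker(M_f − t) = 2` iff `t = AB(λ−μ)^{2n}`, else `0`)

HONEST FRAMING. Part of the Lean index of the computation cell `pub-hsemireg` (seat w3-mod4-1 gen 9, W3 SPECIAL FIBRES; file of
record `HOME/widen/W3/MOD4-OFFSPLIT-w3mod4.md` (E21)/(E22), §9.7–§9.9, §10.2 (C7)/(C8); sheet THEOREM R₂). ELEMENTARY LINEAR ALGEBRA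
of one explicit `(n+1) × (n+1)` matrix over a field ONLY: no abelian variety, no sheaf, no Ext group, no semiregularity map;
nothing here says that HC / HC_CM / HC_AV holds; no Literature fact is declared; NO definition is introduced (the two-slope
sequence `q_m = A λ^m + B μ^m` and the vectors `g_λ = (λ^{n-a})_a`, `e_λ = ((-1)^b C(n,b) λ^b)_b` are written out).

WHAT IS PROVED. gen 4's `Mod4TwoSlopeSpectrum.lean` treated the normal form `f = 1 + e^h` (`A = B = 1`, `λ = 0`, `μ = 1`); the
general two-slope h-part was reduced to it on paper (LEMMA S, scalings). Here the GENERAL case directly, via gen 4's square-root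
form `M_f = (-1)ⁿ T_f²` (`Mod4.middleM_eq_smul_hankelT_sq`):
* `altBinom_dotProduct_geom` — `Σ_b (-1)^b C(n,b) λ^b μ'^{n-b} = (μ' - λ)^n` (so `e_λ · g_λ = 0` for `n ≥ 1`, `e_λ · g_μ = (μ-λ)^n`);
* `hankelT_twoSlope_mulVec` — `T_f v = A (e_λ·v) g_λ + B (e_μ·v) g_μ` (`T_f` has rank `≤ 2`);
* **`middleM_twoSlope_mulVec`** — `M_f v = AB(λ-μ)^n (e_μ·v) g_λ + AB(μ-λ)^n (e_λ·v) g_μ` (`n ≥ 1`);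
* `middleM_twoSlope_mulVec_geom_left/right` — `M_f g_λ = AB(λ-μ)^{2n} g_λ`, `M_f g_μ = AB(λ-μ)^{2n} g_μ`;
* **`finrank_ker_middleM_twoSlope_box`** — `A, B ≠ 0`, `λ ≠ μ`, `n ≥ 1`: `dim ker(M_f - AB(λ-μ)^{2n}) = 2` (the plane `⟨g_λ, g_μ⟩`);
* **`finrank_ker_middleM_twoSlope_generic`** — `t ≠ 0`, `t ≠ AB(λ-μ)^{2n}`: `dim ker(M_f - t) = 0`;
* **`hankel1_rank_twoSlope`** — the Hankel matrices `H_k(q)` (`1 ≤ k ≤ N - 1`) of a two-slope sequence have rank `2`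
  (`r_k = ρ(f) = 2` in THEOREM R_f);
* **`mukaiP_twoSlope`** — `Σ_{j ≤ 2n} (-1)^j C(2n,j) q_j q_{2n-j} = 2·AB(λ-μ)^{2n}` (`n ≥ 1`): the h-part's Mukai self-pairing
  `P_f(q)` is TWICE the distinguished eigenvalue, so (with `WeilFrameMukaiPairing`) «`t` is the eigenvalue» ⟺ «`∫w² = (f,f)_χ`», the
  sheet's BOX LOCUS, for every `n`.
Everything PROVED, 0 sorry. Namespace `Summit.Ventures.HSemireg.Mod4`.
References: [BourbakiAlgebre1a3] Ch. III §8 (determinants, rank); [BuchweitzFlenner2008HH] Prop. 6.4.4 (why this matrix).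
-/

namespace Summit.Ventures.HSemireg.Mod4

open Finset Matrix

variable {K : Type*} [Field K]

/-! ### 1. The alternating binomial pairing against a geometric vector -/

/-- `Σ_{b ≤ n} (-1)^b C(n,b) λ^b μ'^{n-b} = (μ' - λ)^n` (binomial theorem), as a dot product over `Fin (n + 1)`.
[cite: BourbakiAlgebre1a3, Ch. III §8] -/
theorem altBinom_dotProduct_geom (n : ℕ) (la mu' : K) :
    (fun b : Fin (n + 1) => (-1 : K) ^ (b : ℕ) * (n.choose (b : ℕ) : K) * la ^ (b : ℕ)) ⬝ᵥ
        (fun a : Fin (n + 1) => mu' ^ (n - (a : ℕ))) = (mu' - la) ^ n := by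
  rw [dotProduct, Fin.sum_univ_eq_sum_range (fun b => (-1 : K) ^ b * (n.choose b : K) * la ^ b * mu' ^ (n - b)) (n + 1),
    show mu' - la = -la + mu' by ring, add_pow]
  refine Finset.sum_congr rfl fun b _ => ?_
  rw [neg_pow]
  ring

/-- `e_λ · g_λ = 0` for `n ≥ 1`. -/
theorem altBinom_dotProduct_geom_self {n : ℕ} (hn : 1 ≤ n) (la : K) :
    (fun b : Fin (n + 1) => (-1 : K) ^ (b : ℕ) * (n.choose (b : ℕ) : K) * la ^ (b : ℕ)) ⬝ᵥ
        (fun a : Fin (n + 1) => la ^ (n - (a : ℕ))) = 0 := by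
  rw [altBinom_dotProduct_geom, sub_self, zero_pow (by omega)]

/-! ### 2. `T_f` and `M_f = (-1)ⁿ T_f²` on a vector, for the two-slope sequence `q_m = A λ^m + B μ^m` -/

/-- **`T_f v = A (e_λ·v) g_λ + B (e_μ·v) g_μ`** for `q_m = A λ^m + B μ^m`: `T_f` is the sum of two rank-one matrices.
[cite: BourbakiAlgebre1a3, Ch. III §8] -/
theorem hankelT_twoSlope_mulVec (n : ℕ) (A B la mu : K) (v : Fin (n + 1) → K) :
    (hankelT n (fun m => A * la ^ m + B * mu ^ m)) *ᵥ v =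
      (A * ((fun b : Fin (n + 1) => (-1 : K) ^ (b : ℕ) * (n.choose (b : ℕ) : K) * la ^ (b : ℕ)) ⬝ᵥ v)) •
          (fun a : Fin (n + 1) => la ^ (n - (a : ℕ))) +
        (B * ((fun b : Fin (n + 1) => (-1 : K) ^ (b : ℕ) * (n.choose (b : ℕ) : K) * mu ^ (b : ℕ)) ⬝ᵥ v)) •
          (fun a : Fin (n + 1) => mu ^ (n - (a : ℕ))) := by
  ext a
  simp only [mulVec, dotProduct, hankelT, Pi.add_apply, Pi.smul_apply, smul_eq_mul, Finset.mul_sum, Finset.sum_mul,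
    ← Finset.sum_add_distrib]
  refine Finset.sum_congr rfl fun b _ => ?_
  rw [pow_add, pow_add]
  ring

/-- **`M_f v = AB(λ-μ)^n (e_μ·v) g_λ + AB(μ-λ)^n (e_λ·v) g_μ`** (`n ≥ 1`) for `q_m = A λ^m + B μ^m`: `M_f` has rank `≤ 2`
with image in the plane `⟨g_λ, g_μ⟩`. [cite: BourbakiAlgebre1a3, Ch. III §8] -/
theorem middleM_twoSlope_mulVec {n : ℕ} (hn : 1 ≤ n) (A B la mu : K) (v : Fin (n + 1) → K) :
    (middleM n (fun m => A * la ^ m + B * mu ^ m)) *ᵥ v =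
      (A * B * (la - mu) ^ n * ((fun b : Fin (n + 1) => (-1 : K) ^ (b : ℕ) * (n.choose (b : ℕ) : K) * mu ^ (b : ℕ)) ⬝ᵥ v)) •
          (fun a : Fin (n + 1) => la ^ (n - (a : ℕ))) +
        (A * B * (mu - la) ^ n * ((fun b : Fin (n + 1) => (-1 : K) ^ (b : ℕ) * (n.choose (b : ℕ) : K) * la ^ (b : ℕ)) ⬝ᵥ v)) •
          (fun a : Fin (n + 1) => mu ^ (n - (a : ℕ))) := by
  have hsgn : ((-1 : K) ^ n) * (mu - la) ^ n = (la - mu) ^ n := by rw [← mul_pow, neg_one_mul, neg_sub]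
  have hsgn' : ((-1 : K) ^ n) * (la - mu) ^ n = (mu - la) ^ n := by rw [← mul_pow, neg_one_mul, neg_sub]
  rw [middleM_eq_smul_hankelT_sq, smul_mulVec, ← mulVec_mulVec, hankelT_twoSlope_mulVec, hankelT_twoSlope_mulVec,
    dotProduct_add, dotProduct_add, dotProduct_smul, dotProduct_smul, dotProduct_smul, dotProduct_smul,
    altBinom_dotProduct_geom_self hn la, altBinom_dotProduct_geom_self hn mu, altBinom_dotProduct_geom n la mu,
    altBinom_dotProduct_geom n mu la]
  ext a
  simp only [Pi.add_apply, Pi.smul_apply, smul_eq_mul, mul_zero, zero_add, add_zero]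
  linear_combination (A * B * ((fun b : Fin (n + 1) => (-1 : K) ^ (b : ℕ) * (n.choose (b : ℕ) : K) * mu ^ (b : ℕ)) ⬝ᵥ v) *
      la ^ (n - (a : ℕ))) * hsgn +
    (A * B * ((fun b : Fin (n + 1) => (-1 : K) ^ (b : ℕ) * (n.choose (b : ℕ) : K) * la ^ (b : ℕ)) ⬝ᵥ v) *
      mu ^ (n - (a : ℕ))) * hsgn'

/-- `M_f g_λ = AB(λ-μ)^{2n} · g_λ` (`n ≥ 1`). -/
theorem middleM_twoSlope_mulVec_geom_left {n : ℕ} (hn : 1 ≤ n) (A B la mu : K) :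
    (middleM n (fun m => A * la ^ m + B * mu ^ m)) *ᵥ (fun a : Fin (n + 1) => la ^ (n - (a : ℕ))) =
      (A * B * (la - mu) ^ (n + n)) • (fun a : Fin (n + 1) => la ^ (n - (a : ℕ))) := by
  rw [middleM_twoSlope_mulVec hn, altBinom_dotProduct_geom n mu la, altBinom_dotProduct_geom_self hn la, mul_zero, zero_smul,
    add_zero, pow_add, ← mul_assoc]

/-- `M_f g_μ = AB(λ-μ)^{2n} · g_μ` (`n ≥ 1`). -/
theorem middleM_twoSlope_mulVec_geom_right {n : ℕ} (hn : 1 ≤ n) (A B la mu : K) :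
    (middleM n (fun m => A * la ^ m + B * mu ^ m)) *ᵥ (fun a : Fin (n + 1) => mu ^ (n - (a : ℕ))) =
      (A * B * (la - mu) ^ (n + n)) • (fun a : Fin (n + 1) => mu ^ (n - (a : ℕ))) := by
  have hev : (mu - la) ^ (n + n) = (la - mu) ^ (n + n) := by
    rw [← neg_sub la mu, neg_pow, ← two_mul, pow_mul, neg_one_sq, one_pow, one_mul]
  rw [middleM_twoSlope_mulVec hn, altBinom_dotProduct_geom n la mu, altBinom_dotProduct_geom_self hn mu, mul_zero, zero_smul,
    zero_add, mul_assoc (A * B), ← pow_add, hev]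

/-! ### 3. The spectrum: the box locus `t = AB(λ-μ)^{2n}` (multiplicity two) and the generic case -/

/-- **THEOREM R₂, BOX CASE, every `n ≥ 1`:** for `q_m = A λ^m + B μ^m` with `A, B ≠ 0`, `λ ≠ μ`,
`dim ker(M_f(q) - AB(λ-μ)^{2n}) = 2` (the eigenspace is the plane `⟨g_λ, g_μ⟩`). [cite: BourbakiAlgebre1a3, Ch. III §8] -/
theorem finrank_ker_middleM_twoSlope_box {n : ℕ} (hn : 1 ≤ n) {A B la mu : K} (hA : A ≠ 0) (hB : B ≠ 0) (hlm : la ≠ mu) :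
    Module.finrank K ↥(LinearMap.ker (Matrix.toLin' (middleM n (fun m => A * la ^ m + B * mu ^ m)) -
      (A * B * (la - mu) ^ (n + n)) • LinearMap.id)) = 2 := by
  set gl : Fin (n + 1) → K := fun a => la ^ (n - (a : ℕ)) with hgl
  set gm : Fin (n + 1) → K := fun a => mu ^ (n - (a : ℕ)) with hgm
  have hc : A * B * (la - mu) ^ (n + n) ≠ 0 := mul_ne_zero (mul_ne_zero hA hB) (pow_ne_zero _ (sub_ne_zero.mpr hlm))
  -- `g_λ`, `g_μ` are independent: read the coordinates `a = n` and `a = n - 1`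
  have hli : LinearIndependent K ![gl, gm] := by
    rw [LinearIndependent.pair_iff]
    intro s t hst
    have h1 := congr_fun hst (Fin.last n)
    have h2 := congr_fun hst ⟨n - 1, by omega⟩
    simp only [hgl, hgm, Pi.add_apply, Pi.smul_apply, smul_eq_mul, Pi.zero_apply, Fin.val_last, Nat.sub_self, pow_zero,
      mul_one] at h1
    simp only [hgl, hgm, Pi.add_apply, Pi.smul_apply, smul_eq_mul, Pi.zero_apply, show n - (n - 1) = 1 by omega, pow_one] at h2
    have ht : t = -s := by linear_combination h1
    rw [ht] at h2
    have hs : s * (la - mu) = 0 := by linear_combination h2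
    rcases mul_eq_zero.mp hs with hs0 | hs0
    · exact ⟨hs0, by rw [ht, hs0, neg_zero]⟩
    · exact absurd (sub_eq_zero.mp hs0) hlm
  have hker : LinearMap.ker (Matrix.toLin' (middleM n (fun m => A * la ^ m + B * mu ^ m)) -
      (A * B * (la - mu) ^ (n + n)) • LinearMap.id) = Submodule.span K (Set.range ![gl, gm]) := by
    apply le_antisymm
    · intro v hv
      rw [LinearMap.mem_ker, LinearMap.sub_apply, Matrix.toLin'_apply, LinearMap.smul_apply, LinearMap.id_apply, sub_eq_zero,
        middleM_twoSlope_mulVec hn] at hv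
      have hv' : v = (A * B * (la - mu) ^ (n + n))⁻¹ •
          ((A * B * (la - mu) ^ n * ((fun b : Fin (n + 1) => (-1 : K) ^ (b : ℕ) * (n.choose (b : ℕ) : K) * mu ^ (b : ℕ)) ⬝ᵥ v)) •
              gl +
            (A * B * (mu - la) ^ n * ((fun b : Fin (n + 1) => (-1 : K) ^ (b : ℕ) * (n.choose (b : ℕ) : K) * la ^ (b : ℕ)) ⬝ᵥ v)) •
              gm) := by
        rw [hv, smul_smul, inv_mul_cancel₀ hc, one_smul]
      rw [hv']
      exact Submodule.smul_mem _ _ (Submodule.add_mem _ (Submodule.smul_mem _ _ (Submodule.subset_span ⟨0, rfl⟩))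
        (Submodule.smul_mem _ _ (Submodule.subset_span ⟨1, rfl⟩)))
    · rw [Submodule.span_le]
      rintro _ ⟨i, rfl⟩
      rw [SetLike.mem_coe, LinearMap.mem_ker, LinearMap.sub_apply, Matrix.toLin'_apply, LinearMap.smul_apply, LinearMap.id_apply,
        sub_eq_zero]
      fin_cases i
      · exact middleM_twoSlope_mulVec_geom_left hn A B la mu
      · exact middleM_twoSlope_mulVec_geom_right hn A B la mu
  rw [hker, finrank_span_eq_card hli, Fintype.card_fin]

/-- **THEOREM R₂, GENERIC CASE, every `n ≥ 1`:** for `q_m = A λ^m + B μ^m` and `t ≠ 0`, `t ≠ AB(λ-μ)^{2n}`: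
`dim ker(M_f(q) - t) = 0`. [cite: BourbakiAlgebre1a3, Ch. III §8] -/
theorem finrank_ker_middleM_twoSlope_generic {n : ℕ} (hn : 1 ≤ n) (A B la mu : K) {t : K} (ht0 : t ≠ 0)
    (ht : t ≠ A * B * (la - mu) ^ (n + n)) :
    Module.finrank K ↥(LinearMap.ker (Matrix.toLin' (middleM n (fun m => A * la ^ m + B * mu ^ m)) - t • LinearMap.id)) = 0 := by
  have hev : (mu - la) ^ (n + n) = (la - mu) ^ (n + n) := by
    rw [← neg_sub la mu, neg_pow, ← two_mul, pow_mul, neg_one_sq, one_pow, one_mul]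
  rw [Submodule.finrank_eq_zero, LinearMap.ker_eq_bot']
  intro v hv
  rw [LinearMap.sub_apply, Matrix.toLin'_apply, LinearMap.smul_apply, LinearMap.id_apply, sub_eq_zero] at hv
  -- pair `M v = t v` against `e_λ` and `e_μ`
  have hM := middleM_twoSlope_mulVec hn A B la mu v
  have hl := congrArg (fun w => (fun b : Fin (n + 1) => (-1 : K) ^ (b : ℕ) * (n.choose (b : ℕ) : K) * la ^ (b : ℕ)) ⬝ᵥ w) hv
  have hm := congrArg (fun w => (fun b : Fin (n + 1) => (-1 : K) ^ (b : ℕ) * (n.choose (b : ℕ) : K) * mu ^ (b : ℕ)) ⬝ᵥ w) hv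
  rw [hM, dotProduct_add, dotProduct_smul, dotProduct_smul, dotProduct_smul, smul_eq_mul, smul_eq_mul, smul_eq_mul] at hl hm
  rw [altBinom_dotProduct_geom_self hn la, altBinom_dotProduct_geom n la mu, mul_zero, zero_add] at hl
  rw [altBinom_dotProduct_geom n mu la, altBinom_dotProduct_geom_self hn mu, mul_zero, add_zero] at hm
  -- `hl : AB(μ-λ)^n (e_λ·v) (μ-λ)^n = t (e_λ·v)`, `hm : AB(λ-μ)^n (e_μ·v) (λ-μ)^n = t (e_μ·v)`
  have hl0 : (fun b : Fin (n + 1) => (-1 : K) ^ (b : ℕ) * (n.choose (b : ℕ) : K) * la ^ (b : ℕ)) ⬝ᵥ v = 0 := by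
    have h : (A * B * (la - mu) ^ (n + n) - t) *
        ((fun b : Fin (n + 1) => (-1 : K) ^ (b : ℕ) * (n.choose (b : ℕ) : K) * la ^ (b : ℕ)) ⬝ᵥ v) = 0 := by
      rw [← hev, pow_add]; linear_combination hl
    exact (mul_eq_zero.mp h).resolve_left (sub_ne_zero.mpr (Ne.symm ht))
  have hm0 : (fun b : Fin (n + 1) => (-1 : K) ^ (b : ℕ) * (n.choose (b : ℕ) : K) * mu ^ (b : ℕ)) ⬝ᵥ v = 0 := by
    have h : (A * B * (la - mu) ^ (n + n) - t) *
        ((fun b : Fin (n + 1) => (-1 : K) ^ (b : ℕ) * (n.choose (b : ℕ) : K) * mu ^ (b : ℕ)) ⬝ᵥ v) = 0 := by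
      rw [pow_add]; linear_combination hm
    exact (mul_eq_zero.mp h).resolve_left (sub_ne_zero.mpr (Ne.symm ht))
  rw [hM, hl0, hm0, mul_zero, mul_zero, zero_smul, zero_smul, zero_add] at hv
  exact (smul_eq_zero.mp hv.symm).resolve_left ht0

/-! ### 4. The h-part's Mukai self-pairing for two slopes -/

/-- **`P_f(q) = 2·AB(λ-μ)^{2n}`** for `q_m = A λ^m + B μ^m`, `n ≥ 1`: `Σ_{j ≤ 2n} (-1)^j C(2n,j) q_j q_{2n-j} = 2AB(λ-μ)^{2n}`
(the `A²`, `B²` terms are `(λ-λ)^{2n} = 0`; the cross terms are `(μ-λ)^{2n} + (λ-μ)^{2n}`). So the distinguished eigenvalue of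
`M_f` is `P_f(q)/2`. [cite: BourbakiAlgebre1a3, Ch. III §8] -/
theorem mukaiP_twoSlope {n : ℕ} (hn : 1 ≤ n) (A B la mu : K) :
    ∑ j ∈ Finset.range (n + n + 1), (-1 : K) ^ j * (((n + n).choose j : ℕ) : K) *
        ((A * la ^ j + B * mu ^ j) * (A * la ^ (n + n - j) + B * mu ^ (n + n - j))) =
      2 * (A * B * (la - mu) ^ (n + n)) := by
  have hev : (mu - la) ^ (n + n) = (la - mu) ^ (n + n) := by
    rw [← neg_sub la mu, neg_pow, ← two_mul, pow_mul, neg_one_sq, one_pow, one_mul]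
  -- the four pieces
  have h0 : ∑ j ∈ Finset.range (n + n + 1), (-1 : K) ^ j * (((n + n).choose j : ℕ) : K) = 0 := by
    have h := add_pow (-1 : K) 1 (n + n)
    rw [neg_add_cancel, zero_pow (by omega)] at h
    rw [h]
    exact Finset.sum_congr rfl fun j _ => by rw [one_pow, mul_one]
  have hcross : ∀ x y : K, ∑ j ∈ Finset.range (n + n + 1), (-1 : K) ^ j * (((n + n).choose j : ℕ) : K) * (x ^ j * y ^ (n + n - j)) =
      (y - x) ^ (n + n) := by
    intro x y
    rw [show y - x = -x + y by ring, add_pow]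
    exact Finset.sum_congr rfl fun j _ => by rw [neg_pow]; ring
  have hsame : ∀ x : K, ∑ j ∈ Finset.range (n + n + 1), (-1 : K) ^ j * (((n + n).choose j : ℕ) : K) * (x ^ j * x ^ (n + n - j)) = 0 := by
    intro x; rw [hcross x x, sub_self, zero_pow (by omega)]
  have hsplit : ∀ j ∈ Finset.range (n + n + 1), (-1 : K) ^ j * (((n + n).choose j : ℕ) : K) *
      ((A * la ^ j + B * mu ^ j) * (A * la ^ (n + n - j) + B * mu ^ (n + n - j))) =
      A * A * ((-1 : K) ^ j * (((n + n).choose j : ℕ) : K) * (la ^ j * la ^ (n + n - j))) +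
        A * B * ((-1 : K) ^ j * (((n + n).choose j : ℕ) : K) * (la ^ j * mu ^ (n + n - j))) +
        A * B * ((-1 : K) ^ j * (((n + n).choose j : ℕ) : K) * (mu ^ j * la ^ (n + n - j))) +
        B * B * ((-1 : K) ^ j * (((n + n).choose j : ℕ) : K) * (mu ^ j * mu ^ (n + n - j))) := by
    intro j _; ring
  rw [Finset.sum_congr rfl hsplit, Finset.sum_add_distrib, Finset.sum_add_distrib, Finset.sum_add_distrib, ← Finset.mul_sum,
    ← Finset.mul_sum, ← Finset.mul_sum, ← Finset.mul_sum, hsame la, hsame mu, hcross la mu, hcross mu la, hev]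
  ring

/-! ### 5. The Hankel matrices of a two-slope sequence have rank two -/

/-- **`rank H_k(q) = 2`** for `q_m = A λ^m + B μ^m`, `A, B ≠ 0`, `λ ≠ μ`, `1 ≤ k`, `k + 1 ≤ N` (`H_k(q)_{i,s} = q_{i+s}`,
`i ≤ k`, `s ≤ N - k`): the range of `H_k` is the plane spanned by the geometric vectors `(λ^i)_i`, `(μ^i)_i`.
[cite: BourbakiAlgebre1a3, Ch. III §8] -/
theorem hankel1_rank_twoSlope {N k : ℕ} (hk1 : 1 ≤ k) (hkN : k + 1 ≤ N) {A B la mu : K} (hA : A ≠ 0) (hB : B ≠ 0)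
    (hlm : la ≠ mu) : (Wedge.Hankel.hankel1 K N k (fun m => A * la ^ m + B * mu ^ m)).rank = 2 := by
  classical
  set H := Wedge.Hankel.hankel1 K N k (fun m => A * la ^ m + B * mu ^ m) with hH
  set gl : Fin (k + 1) → K := fun i => la ^ (i : ℕ) with hgl
  set gm : Fin (k + 1) → K := fun i => mu ^ (i : ℕ) with hgm
  have hml : mu - la ≠ 0 := sub_ne_zero.mpr (Ne.symm hlm)
  have hmul : ∀ v : Fin (N + 1 - k) → K,
      H *ᵥ v = (A * ∑ s : Fin (N + 1 - k), la ^ (s : ℕ) * v s) • gl + (B * ∑ s : Fin (N + 1 - k), mu ^ (s : ℕ) * v s) • gm := by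
    intro v
    ext i
    simp only [hH, Wedge.Hankel.hankel1, mulVec, dotProduct, Matrix.of_apply, hgl, hgm, Pi.add_apply, Pi.smul_apply,
      smul_eq_mul, Finset.mul_sum, Finset.sum_mul, ← Finset.sum_add_distrib]
    refine Finset.sum_congr rfl fun s _ => ?_
    rw [pow_add, pow_add]
    ring
  have hcol : ∀ s₀ : Fin (N + 1 - k), H *ᵥ Pi.single s₀ 1 = (A * la ^ (s₀ : ℕ)) • gl + (B * mu ^ (s₀ : ℕ)) • gm := by
    intro s₀
    rw [hmul]
    simp only [Pi.single_apply, mul_ite, mul_one, mul_zero, Finset.sum_ite_eq', Finset.mem_univ, if_true]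
  -- independence of `gl`, `gm` (coordinates `0` and `1`; `k ≥ 1`)
  have hli : LinearIndependent K ![gl, gm] := by
    rw [LinearIndependent.pair_iff]
    intro s t hst
    have h0 := congr_fun hst ⟨0, by omega⟩
    have h1 := congr_fun hst ⟨1, by omega⟩
    simp only [hgl, hgm, Pi.add_apply, Pi.smul_apply, smul_eq_mul, Pi.zero_apply, pow_zero, pow_one, mul_one] at h0 h1
    have ht : t = -s := by linear_combination h0
    rw [ht] at h1
    have hs : s * (la - mu) = 0 := by linear_combination h1
    rcases mul_eq_zero.mp hs with hs0 | hs0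
    · exact ⟨hs0, by rw [ht, hs0, neg_zero]⟩
    · exact absurd (sub_eq_zero.mp hs0) hlm
  -- the range of `H` is the plane `⟨gl, gm⟩`
  have hrange : LinearMap.range H.mulVecLin = Submodule.span K (Set.range ![gl, gm]) := by
    apply le_antisymm
    · rintro _ ⟨v, rfl⟩
      rw [Matrix.mulVecLin_apply, hmul]
      exact Submodule.add_mem _ (Submodule.smul_mem _ _ (Submodule.subset_span ⟨0, rfl⟩))
        (Submodule.smul_mem _ _ (Submodule.subset_span ⟨1, rfl⟩))
    · have h0 := hcol ⟨0, by omega⟩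
      have h1 := hcol ⟨1, by omega⟩
      simp only [pow_zero, mul_one, pow_one] at h0 h1
      have hgl' : (A * B * (mu - la)) • gl = (B * mu) • (H *ᵥ Pi.single ⟨0, by omega⟩ 1) - B • (H *ᵥ Pi.single ⟨1, by omega⟩ 1) := by
        rw [h0, h1]
        ext i
        simp only [Pi.smul_apply, Pi.sub_apply, Pi.add_apply, smul_eq_mul]
        ring
      have hgm' : (A * B * (la - mu)) • gm = (A * la) • (H *ᵥ Pi.single ⟨0, by omega⟩ 1) - A • (H *ᵥ Pi.single ⟨1, by omega⟩ 1) := by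
        rw [h0, h1]
        ext i
        simp only [Pi.smul_apply, Pi.sub_apply, Pi.add_apply, smul_eq_mul]
        ring
      have hmem0 : H *ᵥ Pi.single (⟨0, by omega⟩ : Fin (N + 1 - k)) 1 ∈ LinearMap.range H.mulVecLin := ⟨_, rfl⟩
      have hmem1 : H *ᵥ Pi.single (⟨1, by omega⟩ : Fin (N + 1 - k)) 1 ∈ LinearMap.range H.mulVecLin := ⟨_, rfl⟩
      have hglm : gl ∈ LinearMap.range H.mulVecLin := by
        have hc : A * B * (mu - la) ≠ 0 := mul_ne_zero (mul_ne_zero hA hB) hml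
        rw [show gl = (A * B * (mu - la))⁻¹ • ((A * B * (mu - la)) • gl) by rw [smul_smul, inv_mul_cancel₀ hc, one_smul], hgl']
        exact Submodule.smul_mem _ _ (Submodule.sub_mem _ (Submodule.smul_mem _ _ hmem0) (Submodule.smul_mem _ _ hmem1))
      have hgmm : gm ∈ LinearMap.range H.mulVecLin := by
        have hc : A * B * (la - mu) ≠ 0 := mul_ne_zero (mul_ne_zero hA hB) (sub_ne_zero.mpr hlm)
        rw [show gm = (A * B * (la - mu))⁻¹ • ((A * B * (la - mu)) • gm) by rw [smul_smul, inv_mul_cancel₀ hc, one_smul], hgm']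
        exact Submodule.smul_mem _ _ (Submodule.sub_mem _ (Submodule.smul_mem _ _ hmem0) (Submodule.smul_mem _ _ hmem1))
      rw [Submodule.span_le]
      rintro _ ⟨i, rfl⟩
      fin_cases i
      · exact hglm
      · exact hgmm
  change Module.finrank K ↥(LinearMap.range H.mulVecLin) = 2
  rw [hrange, finrank_span_eq_card hli, Fintype.card_fin]

end Summit.Ventures.HSemireg.Mod4
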